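import Literature.Geometry.ComplexHyperbolic.UnitBallInvariantMeasure   -- ★ proper orbit map, `liftMeasure`, `exists_map_orbit_eq_smul` (invariant measures on `𝔹²` vs Haar on `U(2,1)`); Borel structures
import Literature.Geometry.ComplexHyperbolic.UnitBallBounds             -- ★ `mat_inv : mat g⁻¹ = J (mat g)ᴴ J`, `J_mul_J`
import HarnessLib

/-!
# `K`-central orbital integrals of `U(2,1)` are ball averages of an affine pencil of rank-one idempotents
# (ROAD A (A3-a): the complex-hyperbolic «hat-box» chart; Rogawski 1990 §8.4 pp. 126–127; Helgason, *Groups and Geometric Analysis* I §1 Thm. 1.9)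

Topic `Geometry/ComplexHyperbolic`; namespace `Literature.Geometry.ComplexHyperbolic.BallModel`.  THEOREMS ONLY (no `def`, no instance, no notation, no axiom, no named fact, no `sorry`).
Cell `pub/hodgecm-mathlib`, ENGINE T1 (crux H413 = `stmt-HodgeConjecture-24833`); floor-1½ preparation, count-neutral, under row (S-d) ∕ `stub_SdCanonical` (SdArch ED. 3 node N1 =
the (L_{U(2,1)}) letter `stub_ArchCentralLimitU21`): brick **ROAD A (A3-a)** of the in-house road to Harish-Chandra's central limit formula on `U(2,1)` (F0P3a-p03 (g10) census c3af6e58 §2 (A3);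
LEAD F0P3a-plan (g9) WORD T8-137, 2026-09-01; author F0P3a-p05 (g12)).  Self-contained in the ball model ★ `UnitBallU21` (`J = diag(1,1,−1)`, `U21`, `Ball = 𝔹²`, `lift`, `x₀`, `g • z`).

THE MATHEMATICS.  In `G = U(2,1) = U(J)`, `J = diag(1,1,−1)`, the elements `k = diag(u,u,v)` (`u, v ∈ S¹`) are CENTRALISED BY `K = U(2) × U(1) = Stab(x₀)` (they sit on the COMPACT wall of
the compact Cartan; `v → u` is the centre).  Writing `diag(u,u,v) = u·1 + (v − u)·E₂₂` and `E₂₂ = P(e₂)`, where for a `J`-negative vector `w` (`Q(w) = |w₀|²+|w₁|²−|w₂|² < 0`)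
`P(w) := Q(w)⁻¹ · (w w^* J)` is the `J`-orthogonal rank-one idempotent onto the line `ℂw` (`P(w)w = w`, `P(cw) = P(w)`), the conjugation `g k g⁻¹` is read through the congruence law
`g · P(w) · g⁻¹ = P(g w)` (`g⁻¹ = J gᴴ J`, `Q(gw) = Q(w)`): **`g · diag(u,u,v) · g⁻¹ = u·1 + (v − u)·P(lift (g • x₀))`** — an AFFINE pencil of rank-one idempotents parametrised by the point
`g • x₀` of the ball `𝔹² = G∕K`.  Hence for every continuous `Θ : M₃(ℂ) → E` and every measure `μ` on `G`:
`∫_G Θ(g k g⁻¹) dμ(g) = ∫_{𝔹²} Θ(u·1 + (v − u)·P(lift z)) d(π_*μ)(z)`, `π(g) = g • x₀` (push-forward along the orbit map), and for `μ` Haar and any invariant Radon measure `ρ ≠ 0` on `𝔹²`,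
`= c · ∫_{𝔹²} … dρ` with `0 < c < ∞` (★ `exists_map_orbit_eq_smul`).  This is the `H²_ℂ` analogue, one complex dimension up, of the rank-one chart ★ H2a∕H2b
(`exists_integral_comp_conj_diag_eq_smul_integral_chart`); the next bricks (A3-b,c) study `v = u e^{iε} → u` against the density `(1 − |z|²)⁻³` (★ `UnitBallJacobian`): `‖P(lift z)‖ ≍ (1−|z|²)⁻¹`,
normaliser `ε²`, boundary term `c″ Θ(u·1)` — the compact-wall → centre half of the `U(2,1)` limit formula.
* §1 algebra of the pencil `P(w) = Q(w)⁻¹ • (vecMulVec w (star w) * J)` (all spelled inline): congruence law, scaling, `P(e₂) = diag(0,0,1)`, `diag(u,u,v) = u•1 + (v−u)•diag(0,0,1)`, membership of `diag(u,u,v)`.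
* §2 **`mat_conj_kCentral_eq`** — the key identity; `continuous_pencil_lift`.
* §3 **`integral_comp_conj_kCentral_eq_integral_map_orbit`**, **`exists_integral_comp_conj_kCentral_eq_smul_integral_of_smulInvariant`**.
HONEST LABEL: HC_CM is proved only modulo the printed citations until rung 0 closes; this file is linear algebra + `integral_map` over ★ ball-model files and pays nothing by itself.

## References
* [Rogawski1990] J. D. Rogawski, *Automorphic Representations of Unitary Groups in Three Variables*, Ann. of Math. Stud. 123 (1990), §8.4 pp. 126–127 (the central limit formula on `U(2,1)`;
  the compact wall), §8.2 pp. 122–123.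
* [Helgason2000] S. Helgason, *Groups and Geometric Analysis* (2000), Ch. I §1 No. 2, Thm. 1.9 (`∫_G f = ∫_{G∕K} ∫_K`).
* [Jacobowitz1990] H. Jacobowitz, *An Introduction to CR Structures* (1990), Ch. 2 §1 (the ball model of `SU(2,1)`).
* [Varadarajan1989] V. S. Varadarajan, *An Introduction to Harmonic Analysis on Semisimple Lie Groups* (1989), §6.4 (rank-one limit formulas via `G∕K`).
-/

set_option autoImplicit false

noncomputable section

open Matrix Complex ComplexConjugate MeasureTheory Measure Topology

namespace Literature.Geometry.ComplexHyperbolic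

namespace BallModel

/-! ## §1 The affine pencil of rank-one idempotents `P(w) = Q(w)⁻¹ • (w w^* J)` -/

section Pencil

/-- **CONGRUENCE LAW FOR `w w^* J`**: for `g ∈ U(2,1)`, `mat g · (w w^* J) · mat g⁻¹ = (gw)(gw)^* J` (`mat g⁻¹ = J (mat g)ᴴ J`, `J² = 1`). [cite: Jacobowitz1990, Ch. 2 §1] -/
theorem mat_mul_vecMulVec_star_mul_J_mul_mat_inv (g : U21) (w : Fin 3 → ℂ) :
    mat g * (vecMulVec w (star w) * J) * mat g⁻¹ = vecMulVec (mat g *ᵥ w) (star (mat g *ᵥ w)) * J := by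
  rw [mat_inv, star_mulVec]
  calc mat g * (vecMulVec w (star w) * J) * (J * (mat g)ᴴ * J)
      = mat g * vecMulVec w (star w) * (J * J) * (mat g)ᴴ * J := by simp only [Matrix.mul_assoc]
    _ = vecMulVec (mat g *ᵥ w) (star w ᵥ* (mat g)ᴴ) * J := by rw [J_mul_J, Matrix.mul_one, mul_vecMulVec, vecMulVec_mul]

/-- **THE PENCIL IS `U(2,1)`-EQUIVARIANT**: `mat g · P(w) · mat g⁻¹ = P(mat g · w)` (the previous law and `Q(gw) = Q(w)`, ★ `Q_mulVec`). [cite: Jacobowitz1990, Ch. 2 §1] -/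
theorem mat_mul_pencil_mul_mat_inv (g : U21) (w : Fin 3 → ℂ) :
    mat g * ((((Q w : ℝ) : ℂ))⁻¹ • (vecMulVec w (star w) * J)) * mat g⁻¹ =
      (((Q (mat g *ᵥ w) : ℝ) : ℂ))⁻¹ • (vecMulVec (mat g *ᵥ w) (star (mat g *ᵥ w)) * J) := by
  rw [Matrix.mul_smul, Matrix.smul_mul, mat_mul_vecMulVec_star_mul_J_mul_mat_inv, Q_mulVec (mat_mem g)]

/-- **THE PENCIL SEES ONLY THE LINE**: `P(c w) = P(w)` for `c ≠ 0` (`(cw)(cw)^* = |c|² w w^*`, `Q(cw) = |c|² Q(w)`). [cite: Jacobowitz1990, Ch. 2 §1] -/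
theorem pencil_smul (w : Fin 3 → ℂ) {c : ℂ} (hc : c ≠ 0) :
    (((Q (c • w) : ℝ) : ℂ))⁻¹ • (vecMulVec (c • w) (star (c • w)) * J) = (((Q w : ℝ) : ℂ))⁻¹ • (vecMulVec w (star w) * J) := by
  have hQ : ((Q (c • w) : ℝ) : ℂ) = (c * conj c) * ((Q w : ℝ) : ℂ) := by
    rw [← form_eq_Q, ← form_eq_Q, star_smul, mulVec_smul, dotProduct_smul, smul_dotProduct, smul_eq_mul, smul_eq_mul, Complex.star_def]
    ring
  have hV : vecMulVec (c • w) (star (c • w)) = (c * conj c) • vecMulVec w (star w) := by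
    rw [star_smul, smul_vecMulVec, vecMulVec_smul, smul_smul, Complex.star_def]
  have hcc : c * conj c ≠ 0 := mul_ne_zero hc ((map_ne_zero _).2 hc)
  rw [hQ, hV, Matrix.smul_mul, smul_smul]
  congr 1
  rw [mul_inv, mul_assoc, mul_comm ((((Q w : ℝ) : ℂ))⁻¹) (c * conj c), ← mul_assoc, inv_mul_cancel₀ hcc, one_mul]

/-- **`P(e₂) = E₂₂ = diag(0,0,1)`** at the base vector `e₂ = lift x₀ = (0,0,1)` (`Q(e₂) = −1`). [cite: Jacobowitz1990, Ch. 2 §1] -/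
theorem pencil_lift_x₀ : (((Q (lift x₀) : ℝ) : ℂ))⁻¹ • (vecMulVec (lift x₀) (star (lift x₀)) * J) = Matrix.diagonal ![(0 : ℂ), 0, 1] := by
  have hQ : Q (lift x₀) = -1 := by simp [Q, lift, x₀]
  rw [hQ]
  ext i j
  fin_cases i <;> fin_cases j <;> simp [vecMulVec, J, lift, x₀, Matrix.mul_apply, Matrix.diagonal]

/-- `diag(u,u,v) = u·1 + (v − u)·diag(0,0,1)`. [cite: Rogawski1990, §8.4 p. 126] -/
theorem diagonal_uuv_eq (u v : ℂ) : Matrix.diagonal ![u, u, v] = u • (1 : Matrix (Fin 3) (Fin 3) ℂ) + (v - u) • Matrix.diagonal ![(0 : ℂ), 0, 1] := by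
  ext i j
  fin_cases i <;> fin_cases j <;> simp [Matrix.diagonal]

/-- **`diag(u,u,v) ∈ U(2,1)` for `u, v ∈ S¹`** (`diag(ū,ū,v̄) J diag(u,u,v) = J`). [cite: Rogawski1990, §8.4 p. 126] -/
theorem diagonal_uuv_preserves (u v : Circle) :
    (Matrix.diagonal ![(u : ℂ), u, v])ᴴ * J * Matrix.diagonal ![(u : ℂ), u, v] = J := by
  have hu : conj (u : ℂ) * u = 1 := by rw [← Complex.normSq_eq_conj_mul_self, Circle.normSq_coe, Complex.ofReal_one]
  have hv : conj (v : ℂ) * v = 1 := by rw [← Complex.normSq_eq_conj_mul_self, Circle.normSq_coe, Complex.ofReal_one]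
  have hu' : (u : ℂ) * conj (u : ℂ) = 1 := by rw [mul_comm, hu]
  have hv' : (v : ℂ) * conj (v : ℂ) = 1 := by rw [mul_comm, hv]
  rw [Matrix.diagonal_conjTranspose, J, Matrix.diagonal_mul_diagonal, Matrix.diagonal_mul_diagonal]
  congr 1
  funext i
  fin_cases i <;> simp [hu, hv]

end Pencil

/-! ## §2 The key identity: `g · diag(u,u,v) · g⁻¹ = u·1 + (v − u)·P(lift (g • x₀))` -/

section Key

/-- **THE KEY IDENTITY (A3-a)**: for `u, v ∈ S¹` and `g ∈ U(2,1)`, `mat(g · diag(u,u,v) · g⁻¹) = u • 1 + (v − u) • P(lift (g • x₀))`, `P(w) = Q(w)⁻¹ • (w w^* J)` — the conjugates of a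
`K`-central element form an AFFINE pencil of rank-one idempotents over the ball `𝔹² = U(2,1)∕K` (§1: `E₂₂ = P(e₂)`, the congruence law, and `lift (g • x₀) = (g e₂)₂⁻¹ • g e₂`, ★ `lift_act`).
[cite: Rogawski1990, §8.4 pp. 126–127] [cite: Jacobowitz1990, Ch. 2 §1] -/
theorem mat_conj_kCentral_eq (g : U21) (u v : Circle) :
    mat (g * mkU21 (Matrix.diagonal ![(u : ℂ), u, v]) (diagonal_uuv_preserves u v) * g⁻¹) =
      (u : ℂ) • (1 : Matrix (Fin 3) (Fin 3) ℂ) + ((v : ℂ) - u) • ((((Q (lift (g • x₀)) : ℝ) : ℂ))⁻¹ • (vecMulVec (lift (g • x₀)) (star (lift (g • x₀))) * J)) := by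
  have hmat : mat (g * mkU21 (Matrix.diagonal ![(u : ℂ), u, v]) (diagonal_uuv_preserves u v) * g⁻¹) = mat g * Matrix.diagonal ![(u : ℂ), u, v] * mat g⁻¹ := by
    simp only [mat, Subgroup.coe_mul, Units.val_mul]; rfl
  have hlift : lift (g • x₀) = (W3 g x₀ 2)⁻¹ • W3 g x₀ := by rw [smul_def, lift_act]
  have hW3 : W3 g x₀ = mat g *ᵥ lift x₀ := rfl
  have hginv : mat g * mat g⁻¹ = 1 := by
    simp only [mat, ← Units.val_mul, ← Subgroup.coe_mul, mul_inv_cancel, Subgroup.coe_one, Units.val_one]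
  rw [hmat, diagonal_uuv_eq, ← pencil_lift_x₀, Matrix.mul_add, Matrix.add_mul, Matrix.mul_smul, Matrix.smul_mul, Matrix.mul_one, hginv, Matrix.mul_smul, Matrix.smul_mul,
    mat_mul_pencil_mul_mat_inv, ← hW3, hlift, pencil_smul _ (inv_ne_zero (W3_2_ne_zero g x₀))]

/-- The pencil along the ball is continuous: `z ↦ P(lift z)` (`Q(lift z) < 0` never vanishes, ★ `Q_lift`). [cite: Jacobowitz1990, Ch. 2 §1] -/
theorem continuous_pencil_lift : Continuous fun z : Ball => (((Q (lift z) : ℝ) : ℂ))⁻¹ • (vecMulVec (lift z) (star (lift z)) * J) := by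
  have h0 : Continuous fun z : Ball => z.1 0 := (continuous_apply 0).comp continuous_coe
  have h1 : Continuous fun z : Ball => z.1 1 := (continuous_apply 1).comp continuous_coe
  have hlift : Continuous fun z : Ball => lift z := by
    unfold lift
    exact h0.matrixVecCons (h1.matrixVecCons continuous_const)
  have hQ : Continuous fun z : Ball => ((Q (lift z) : ℝ) : ℂ) := by
    refine Complex.continuous_ofReal.comp ?_
    unfold Q
    fun_prop
  have hQinv : Continuous fun z : Ball => (((Q (lift z) : ℝ) : ℂ))⁻¹ :=
    hQ.inv₀ fun z => by exact_mod_cast (Q_lift z).ne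
  exact hQinv.smul ((hlift.matrix_vecMulVec hlift.star).mul continuous_const)

end Key

/-! ## §3 The orbital integral at a `K`-central element as a ball average -/

section Integral

variable {E : Type*} [NormedAddCommGroup E] [NormedSpace ℝ E]

/-- **`K`-CENTRAL ORBITAL INTEGRALS ARE BALL AVERAGES**: for every measure `μ` on `U(2,1)`, every continuous `Θ : M₃(ℂ) → E` and `u, v ∈ S¹`:
`∫_{U(2,1)} Θ(mat(g·diag(u,u,v)·g⁻¹)) dμ(g) = ∫_{𝔹²} Θ(u•1 + (v−u)•P(lift z)) d(π_*μ)(z)`, `π(g) = g • x₀` (§2 and Mathlib `integral_map` along the continuous orbit map).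
[cite: Rogawski1990, §8.4 pp. 126–127] [cite: Helgason2000, Ch. I §1 No. 2, Thm. 1.9] -/
theorem integral_comp_conj_kCentral_eq_integral_map_orbit (μ : Measure U21) (Θ : Matrix (Fin 3) (Fin 3) ℂ → E) (hΘ : Continuous Θ) (u v : Circle) :
    ∫ g, Θ (mat (g * mkU21 (Matrix.diagonal ![(u : ℂ), u, v]) (diagonal_uuv_preserves u v) * g⁻¹)) ∂μ =
      ∫ z, Θ ((u : ℂ) • (1 : Matrix (Fin 3) (Fin 3) ℂ) + ((v : ℂ) - u) • ((((Q (lift z) : ℝ) : ℂ))⁻¹ • (vecMulVec (lift z) (star (lift z)) * J))) ∂(μ.map fun g : U21 => g • x₀) := by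
  simp_rw [mat_conj_kCentral_eq]
  have hπ : Measurable fun g : U21 => g • x₀ := (continuous_id.smul continuous_const).measurable
  have hF : Continuous fun z : Ball => Θ ((u : ℂ) • (1 : Matrix (Fin 3) (Fin 3) ℂ) + ((v : ℂ) - u) • ((((Q (lift z) : ℝ) : ℂ))⁻¹ • (vecMulVec (lift z) (star (lift z)) * J))) :=
    hΘ.comp (continuous_const.add (continuous_pencil_lift.const_smul (((v : ℂ)) - u)))
  haveI : SecondCountableTopology Ball := inferInstanceAs (SecondCountableTopology {z : Fin 2 → ℂ // nsq z < 1})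
  rw [integral_map hπ.aemeasurable hF.aestronglyMeasurable]

/-- **… AND AGAINST ANY INVARIANT RADON MEASURE `ρ ≠ 0` ON THE BALL**: for `μ` a Haar measure on `U(2,1)` there is `0 < c < ∞` (★ `exists_map_orbit_eq_smul`: `π_*μ = c • ρ`) with
`∫_{U(2,1)} Θ(mat(g·diag(u,u,v)·g⁻¹)) dμ = c · ∫_{𝔹²} Θ(u•1 + (v−u)•P(lift z)) dρ(z)` — the `G∕K` form in which the (A3-b) asymptotics `v → u` are read against the explicit density of `ρ`.
[cite: Helgason2000, Ch. I §1 No. 2, Thm. 1.9] [cite: Rogawski1990, §8.4 pp. 126–127] -/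
theorem exists_integral_comp_conj_kCentral_eq_smul_integral_of_smulInvariant (μ : Measure U21) [μ.IsHaarMeasure] (ρ : Measure Ball)
    [SMulInvariantMeasure U21 Ball ρ] [IsFiniteMeasureOnCompacts ρ] (hρ : ρ ≠ 0) :
    ∃ c : ℝ, 0 < c ∧ ∀ (Θ : Matrix (Fin 3) (Fin 3) ℂ → E), Continuous Θ → ∀ u v : Circle,
      ∫ g, Θ (mat (g * mkU21 (Matrix.diagonal ![(u : ℂ), u, v]) (diagonal_uuv_preserves u v) * g⁻¹)) ∂μ =
        c • ∫ z, Θ ((u : ℂ) • (1 : Matrix (Fin 3) (Fin 3) ℂ) + ((v : ℂ) - u) • ((((Q (lift z) : ℝ) : ℂ))⁻¹ • (vecMulVec (lift z) (star (lift z)) * J))) ∂ρ := by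
  obtain ⟨c, hc0, hct, hc⟩ := exists_map_orbit_eq_smul μ ρ hρ
  refine ⟨c.toReal, ENNReal.toReal_pos hc0 hct, fun Θ hΘ u v => ?_⟩
  rw [integral_comp_conj_kCentral_eq_integral_map_orbit μ Θ hΘ u v, hc, integral_smul_measure]

end Integral

end BallModel

end Literature.Geometry.ComplexHyperbolic

end
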